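import Summits.AtomisticToContinuum.HydrodynamicLimit.Theses.TwoTimePressureGerm
import Summits.AtomisticToContinuum.HydrodynamicLimit.Theorems.CollisionActivityTails.Negative.EquilibriumReduction

/-!
# Negative knowledge for the crux `TwoTimePressureGerm.TiltSubGaussian` — frame non-vacuity and the equilibrium rung

Refuter vetting pass (crux-attack, refuter-rattack-stmt-AtomisticToContinuum-17755-0) on the crux
`Summit.AtomisticToContinuum.HydrodynamicLimit.Theses.TwoTimePressureGerm.TiltSubGaussian`
(stmt-AtomisticToContinuum-17755, route TwoTimePressureGerm item #5).  Nothing here asserts the crux.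

* `tiltSubGaussian_frame_nonvacuous`: WHATEVER packing threshold `η₀ > 0` and diluteness threshold `σ₀ > 0`
  the two leading existentials pick, the universally quantified hypotheses of the crux (classical hard-sphere
  Euler solution on `[0, 1)`, packing guard, flow family, `t = 0` law of large numbers of the local Gibbs laws)
  are jointly dischargeable IN THE TREE at constant profiles — constant states
  (`isHardSphereEulerSolution_const`), Alexander flows (`flows_nonempty`), the constant-density LLN
  (`localGibbs_lln_holds` pinned to `rhoLim` by `density_zero_eq_rhoLim`, constant by `rhoLim_const`, and
  `< (2e+1)·M` uniformly in `σ` by `rhoLim_lt`, so the guard holds once `σ < η₀ / ((2e+1)M)`).  Hence the crux is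
  not vacuously true: its conclusion is exercised (at least) on the global Gibbs states.
* `equilibrium_of_tiltSubGaussian`: the crux implies its EQUILIBRIUM RUNG `EquilibriumTiltSubGaussian` — the
  N-uniform quadratic cgf window of the three time-`t` conserved fields under the CANONICAL Gibbs law with drift
  `u` and temperature `θ` (constant activity), along every hard-sphere flow family, for every `t ≥ 0`.
  Contrapositive `not_tiltSubGaussian_of_not_equilibrium`: any super-CLT Euler-scale fluctuation of a conserved
  field AT GLOBAL EQUILIBRIUM refutes the crux.  (By invariance of the canonical law under the flow the rung is a
  STATIC sub-Gaussian concentration statement — classical at small `σ` by the canonical cluster expansion — so the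
  equilibrium instance is no counterexample; recorded as the weakest consequence / first proof obligation.)
-/

noncomputable section

open MeasureTheory Filter Set Topology
open scoped ENNReal

namespace Summit.AtomisticToContinuum.HydrodynamicLimit.Theorems

namespace TiltSubGaussianEquilibrium

open Literature.MathematicalPhysics.KineticTheory Literature.Analysis.FluidPDE
open DenseExcursionAtTimeZero (density_zero_eq_rhoLim rhoLim_lt)
open DenseExcursionUntied (isHardSphereEulerSolution_const)
open CollisionActivityTailsEquilibrium (Flow flows_nonempty rhoLim_const)

/-- **Constant-profile statics with a packing margin**: for constant activity/velocity/temperature and every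
`η₀ > 0` there is `σ₁ > 0` such that for `0 < σ < σ₁` some constant density `r > 0` with `r σ³ < η₀` is the
`t = 0` LLN limit of the local Gibbs density field along EVERY flow family (velocity `u`, temperature `θ`). -/
theorem constantLLN_with_margin (η₀ : ℝ) (hη₀ : 0 < η₀) (a θ : ℝ) (u : V3) (ha : 0 < a) (hθ : 0 < θ) :
    ∃ σ₁ : ℝ, 0 < σ₁ ∧ σ₁ ≤ 1 / 2 ∧ ∀ σ : ℝ, 0 < σ → σ < σ₁ → ∃ r : ℝ, 0 < r ∧ r * σ ^ 3 < η₀ ∧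
      ∀ Φ : (N : ℕ) → Flow σ N,
        TendstoHydroFieldsAt (fun N => localGibbsLaw σ (fun _ => a) (fun _ => u) (fun _ => θ) N (Φ N))
          Φ (fun _ _ => r) (fun _ _ => u) (fun _ _ => θ) 0 := by
  obtain ⟨σa, hσa, Ha⟩ := localGibbs_lln_holds (fun _ => a) (fun _ => θ) (fun _ => u)
    continuous_const continuous_const continuous_const (fun _ => ha) (fun _ => hθ)
  obtain ⟨σb, hσb, hσb2, Hb⟩ := density_zero_eq_rhoLim (a₀ := fun _ : T3 => a) (θ₀ := fun _ => θ)
    (u₀ := fun _ => u) continuous_const continuous_const continuous_const (fun _ => ha)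
    (fun _ => hθ)
  set P := profileOf (fun _ : T3 => a) continuous_const (fun _ => ha) with hP
  set B : ℝ := (2 * Real.exp 1 + 1) * P.M with hBdef
  have hB : 0 < B := by
    have := P.M_pos
    positivity
  refine ⟨min (min σa σb) (min 1 (η₀ / B)),
    lt_min (lt_min hσa hσb) (lt_min one_pos (div_pos hη₀ hB)),
    ((min_le_left _ _).trans (min_le_right _ _)).trans hσb2, fun σ hσ hσlt => ?_⟩
  have hσa' : σ < σa := hσlt.trans_le ((min_le_left _ _).trans (min_le_left _ _))
  have hσb' : σ < σb := hσlt.trans_le ((min_le_left _ _).trans (min_le_right _ _))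
  have hσ1 : σ < 1 := hσlt.trans_le ((min_le_right _ _).trans (min_le_left _ _))
  have hσB : σ < η₀ / B := hσlt.trans_le ((min_le_right _ _).trans (min_le_right _ _))
  have hσ2 : σ < 1 / 2 := hσb'.trans_le hσb2
  obtain ⟨h, hpin⟩ := Hb σ hσ hσb'
  obtain ⟨ρ₀, hρc, hρpos, Hlln⟩ := Ha σ hσ hσa'
  obtain ⟨Φ⟩ := flows_nonempty hσ hσ2
  have hid : ρ₀ = rhoLim P σ :=
    hpin (fun _ => ρ₀) (fun _ _ => θ) (fun _ _ => u) Φ hρc (Hlln Φ).2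
  have hconst : rhoLim P σ = fun _ => ρ₀ 0 := by
    funext x
    rw [hid]
    exact rhoLim_const ha σ x 0
  have hlt : ρ₀ 0 < B := by
    have h1 := rhoLim_lt h 0
    rw [hconst] at h1
    simpa [hBdef] using h1
  refine ⟨ρ₀ 0, hρpos 0, ?_, fun Ψ => ?_⟩
  · have hσ3 : σ ^ 3 ≤ σ := pow_le_of_le_one hσ.le hσ1.le (by norm_num)
    calc ρ₀ 0 * σ ^ 3 ≤ B * σ := mul_le_mul hlt.le hσ3 (by positivity) hB.le
      _ < B * (η₀ / B) := mul_lt_mul_of_pos_left hσB hB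
      _ = η₀ := mul_div_cancel₀ η₀ hB.ne'
  · have hT := (Hlln Ψ).2
    rw [hid, hconst] at hT
    exact hT

/-- **Non-vacuity of the frame of `TiltSubGaussian`**: for every `η₀ > 0`, constant positive profile data and
every `σ₀ > 0` there is `σ ∈ (0, σ₀)` at which a classical hard-sphere Euler solution on `[0, 1)` satisfying the
packing guard, a flow family, and the `t = 0` LLN tie ALL exist (so the crux's conclusion is exercised). -/
theorem tiltSubGaussian_frame_nonvacuous (η₀ : ℝ) (hη₀ : 0 < η₀) (a θ : ℝ) (u : V3) (ha : 0 < a)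
    (hθ : 0 < θ) (σ₀ : ℝ) (hσ₀ : 0 < σ₀) :
    ∃ σ : ℝ, 0 < σ ∧ σ < σ₀ ∧ ∃ (ρ θf : ℝ → T3 → ℝ) (uf : ℝ → T3 → V3),
      IsHardSphereEulerSolution σ 1 ρ uf θf ∧ (∀ t ∈ Set.Ico (0 : ℝ) 1, ∀ x, ρ t x * σ ^ 3 < η₀) ∧
      Nonempty ((N : ℕ) → Flow σ N) ∧
      ∀ Φ : (N : ℕ) → Flow σ N,
        TendstoHydroFieldsAt (fun N => localGibbsLaw σ (fun _ => a) (fun _ => u) (fun _ => θ) N (Φ N))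
          Φ ρ uf θf 0 := by
  obtain ⟨σ₁, hσ₁, hσ₁2, H⟩ := constantLLN_with_margin η₀ hη₀ a θ u ha hθ
  have hσ : 0 < min σ₀ σ₁ / 2 := by positivity
  have hσ₀' : min σ₀ σ₁ / 2 < σ₀ := by
    have := min_le_left σ₀ σ₁
    linarith
  have hσ₁' : min σ₀ σ₁ / 2 < σ₁ := by
    have := min_le_right σ₀ σ₁
    linarith
  obtain ⟨r, hr, hrη, Hl⟩ := H _ hσ hσ₁'
  exact ⟨_, hσ, hσ₀', fun _ _ => r, fun _ _ => θ, fun _ _ => u,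
    isHardSphereEulerSolution_const _ 1 u hr hθ, fun _ _ _ => hrη,
    flows_nonempty hσ (hσ₁'.trans_le hσ₁2), Hl⟩

/-- **The equilibrium rung of `TiltSubGaussian`** (the crux's conclusion verbatim at constant profiles, for every
`t ≥ 0`, profile-wise `σ₀`): under the canonical Gibbs law with activity `a`, drift `u`, temperature `θ`, along
every hard-sphere flow family, the scaled cgf of each time-`t` conserved field around its mean is N-uniformly
quadratic on a window `|b| ≤ r`. -/
def EquilibriumTiltSubGaussian : Prop :=
  ∀ (a θ : ℝ) (u : V3), 0 < a → 0 < θ → ∃ σ₀ : ℝ, 0 < σ₀ ∧ ∀ σ : ℝ, 0 < σ → σ < σ₀ →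
    ∀ Φ : (N : ℕ) → Flow σ N, ∀ t : ℝ, 0 ≤ t → ∀ χ : T3 → ℝ, Continuous χ →
      ∃ r : ℝ, 0 < r ∧ ∃ K : ℝ, ∀ᶠ N : ℕ in atTop, ∀ b ∈ Set.Icc (-r) r,
        ∫⁻ z, ENNReal.ofReal (Real.exp (((N : ℝ) + 1) * b *
            (empiricalDensityField ((Φ N).flow t z) χ -
              ∫ w, empiricalDensityField ((Φ N).flow t w) χ
                ∂(localGibbsLaw σ (fun _ => a) (fun _ => u) (fun _ => θ) N (Φ N)))))
          ∂(localGibbsLaw σ (fun _ => a) (fun _ => u) (fun _ => θ) N (Φ N)) ≤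
          ENNReal.ofReal (Real.exp (((N : ℝ) + 1) * K * b ^ 2)) ∧
        (∀ i : Fin 3, ∫⁻ z, ENNReal.ofReal (Real.exp (((N : ℝ) + 1) * b *
            (empiricalMomentumField ((Φ N).flow t z) χ i -
              ∫ w, empiricalMomentumField ((Φ N).flow t w) χ i
                ∂(localGibbsLaw σ (fun _ => a) (fun _ => u) (fun _ => θ) N (Φ N)))))
          ∂(localGibbsLaw σ (fun _ => a) (fun _ => u) (fun _ => θ) N (Φ N)) ≤
          ENNReal.ofReal (Real.exp (((N : ℝ) + 1) * K * b ^ 2))) ∧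
        ∫⁻ z, ENNReal.ofReal (Real.exp (((N : ℝ) + 1) * b *
            (empiricalEnergyField ((Φ N).flow t z) χ -
              ∫ w, empiricalEnergyField ((Φ N).flow t w) χ
                ∂(localGibbsLaw σ (fun _ => a) (fun _ => u) (fun _ => θ) N (Φ N)))))
          ∂(localGibbsLaw σ (fun _ => a) (fun _ => u) (fun _ => θ) N (Φ N)) ≤
          ENNReal.ofReal (Real.exp (((N : ℝ) + 1) * K * b ^ 2))

/-- **Reduction**: the crux implies its equilibrium rung (instantiate at constant profiles, the constant classical
solution on `[0, t+1)` pinned by the constant-density LLN, packing guard from the margin). -/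
theorem equilibrium_of_tiltSubGaussian
    (h : Summit.AtomisticToContinuum.HydrodynamicLimit.Theses.TwoTimePressureGerm.TiltSubGaussian) :
    EquilibriumTiltSubGaussian := by
  obtain ⟨η₀, hη₀, H⟩ := h
  intro a θ u ha hθ
  obtain ⟨σc, hσc, Hc⟩ := H (fun _ => a) (fun _ => θ) (fun _ => u) continuous_const continuous_const
    continuous_const (fun _ => ha) (fun _ => hθ)
  obtain ⟨σ₁, hσ₁, -, H₁⟩ := constantLLN_with_margin η₀ hη₀ a θ u ha hθ
  refine ⟨min σc σ₁, lt_min hσc hσ₁, fun σ hσ hσlt Φ t ht χ hχ => ?_⟩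
  obtain ⟨r, hr, hrη, Hl⟩ := H₁ σ hσ (hσlt.trans_le (min_le_right _ _))
  exact Hc σ hσ (hσlt.trans_le (min_le_left _ _)) (t + 1) (fun _ _ => r) (fun _ _ => θ) (fun _ _ => u)
    (isHardSphereEulerSolution_const σ (t + 1) u hr hθ) (fun _ _ _ => hrη) Φ (Hl Φ) t
    ⟨ht, by linarith⟩ χ hχ

/-- Contrapositive: **any counterexample to the equilibrium rung refutes the crux.** -/
theorem not_tiltSubGaussian_of_not_equilibrium (h : ¬ EquilibriumTiltSubGaussian) :
    ¬ Summit.AtomisticToContinuum.HydrodynamicLimit.Theses.TwoTimePressureGerm.TiltSubGaussian :=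
  fun hc => h (equilibrium_of_tiltSubGaussian hc)

end TiltSubGaussianEquilibrium

end Summit.AtomisticToContinuum.HydrodynamicLimit.Theorems

end
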